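import Mathlib
import Summits.NavierStokesRegularity.NavierStokesRegularity.Theorems.EulerZoomLiouvillePowerGaugeEulerLiouvilleDSSEndpointShellTools
import Summits.NavierStokesRegularity.NavierStokesRegularity.Theorems.EulerZoomLiouvillePowerGaugeEulerLiouvilleSelfSimilarEndpointFlux
import HarnessLib

/-!
# Rung C2 of the crux `EulerZoomLiouville.PowerGaugeEulerLiouville` at the endpoint `ρ = 1/2`:
# the period-integrated shell inequality of DISCRETELY self-similar members (weak class)

Route №10 `EulerZoomLiouville` (NavierStokesRegularity), crux E = stmt-NavierStokesRegularity-19832,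
tenure rung C2 (`Sig.rungC2_dss`: discretely self-similar members of Seregin's power-gauged ancient
Euler class vanish) at the energy-conserving endpoint `ρ = 1/2` (Chae–Shvydkoy `α = N/2`).  A member
`(u, p)` is DISCRETELY SELF-SIMILAR with factor `l > 1` at `ρ = 1/2` when
`u(τ, y) = l^{3/2} u(l^{5/2} τ, l y)`, `p(τ, y) = l³ p(l^{5/2} τ, l y)` (`τ < 0`); exactly self-similar
members (rung C1) are the case of every factor.  This file is the DSS analogue, in the weak class
and in PHYSICAL variables, of Chae–Shvydkoy's starting inequality (3.2) / Chae–Tsai's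
period-integrated local energy inequality (Lemma 3.1, there for `C¹` profiles with the local
energy EQUALITY):

* `dss_half_periodShell_le` — for a DSS member with factor `l ≥ 2`, a time `τ₀ < 0` and every
  `L > 0`, with `I₀ = (l^{5/2} τ₀, τ₀)` one period and `F = |u|³ + 2|p||u|`,
  `∫_{I₀} ∫_{2L/l ≤ |y| ≤ L} |u|² ≤ (K/L) [ ∫_{I₀} ∫_{L ≤ |y| ≤ 2L} F + l ∫_{I₀} ∫_{L/l ≤ |y| ≤ 2L/l} F ]`.
  Proof: the lead's two-time local energy inequality `ae_energy_le_add_flux` between a slice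
  `τ₁ ∈ (l⁵τ₀, l^{5/2}τ₀)` and a slice `τ₂ ∈ I₀` against the FIXED cut-off `σ_{2L}`; DSS turns
  `∫ |u(τ₁)|² σ_{2L}` into `∫ |u(τ₁/l^{5/2})|² σ_{2L/l}`; averaging BOTH times over `I₀` (no
  product-a.e. issue) bounds `∫_{I₀} ∫ |u|² (σ_{2L} − σ_{2L/l})` by `|I₀|` times the flux through the
  shell of `σ_{2L}` over two periods, and the earlier period's flux is the flux at scale `L/l` over
  `I₀`.  Only the FORWARD (inequality) direction of the class is used.

WHAT THIS IS NOT: not NS, not E, not rung C2 — one inequality of one endpoint stratum.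
-/


noncomputable section

-- flat `Theorems/<Route><Decl>…` files of one crux share the namespace of the crux (tree convention)
set_option linter.dupNamespace false

open MeasureTheory Set Filter Topology Metric Function TopologicalSpace
open scoped ENNReal NNReal InnerProductSpace RealInnerProductSpace Laplacian

namespace Summit.NavierStokesRegularity.NavierStokesRegularity.Theorems.PowerGaugeEulerLiouville

open Literature.Analysis Literature.Analysis.FunctionSpaces Literature.Analysis.FluidPDE
/-! ## The period-integrated shell inequality -/

section PeriodShell

variable {u : ℝ → EuclideanSpace ℝ (Fin 3) → EuclideanSpace ℝ (Fin 3)}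
  {p : ℝ → EuclideanSpace ℝ (Fin 3) → ℝ}

/-- **The period-integrated shell inequality of a DSS member at the endpoint (weak class).**
Let `(u, p)` be a suitable weak Euler pair on the slab `(−∞,0) × ℝ³`, discretely self-similar with
factor `l ≥ 2` for the class scaling at `ρ = 1/2`: `u(τ, y) = l^{3/2} u(l^{5/2} τ, l y)`,
`p(τ, y) = l³ p(l^{5/2} τ, l y)` (`τ < 0`).  Then for every `τ₀ < 0` there is `K ≥ 0` such that
for every `L > 0`, with `I₀ = (l^{5/2} τ₀, τ₀)` and `F = |u|³ + 2|p||u|`,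
`∫_{I₀} ∫_{2L/l ≤ |y| ≤ L} |u|² ≤ (K/L) (∫_{I₀} ∫_{L ≤ |y| ≤ 2L} F + l ∫_{I₀} ∫_{L/l ≤ |y| ≤ 2L/l} F)`.
This is Chae–Tsai's period-integrated local energy inequality (Lemma 3.1) / Chae–Shvydkoy's
(3.2) for DSS members of Seregin's class, from the FORWARD two-time inequality only.
[cite: ChaeTsai2014, §3 Lemma 3.1; ChaeShvydkoy2013, §3.1 eq. (3.2)] -/
theorem dss_half_periodShell_le
    (hsw : IsSuitableWeakSolutionOn (slab (EuclideanSpace ℝ (Fin 3)) (Iio 0) isOpen_Iio) 0 0 u p)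
    {l : ℝ} (hl : 2 ≤ l)
    (hu : ∀ τ : ℝ, τ < 0 → ∀ y, u τ y = (l ^ (3 / 2 : ℝ)) • u (l ^ (5 / 2 : ℝ) * τ) (l • y))
    (hp : ∀ τ : ℝ, τ < 0 → ∀ y, p τ y = l ^ 3 * p (l ^ (5 / 2 : ℝ) * τ) (l • y))
    {τ₀ : ℝ} (hτ₀ : τ₀ < 0) :
    ∃ K : ℝ, 0 ≤ K ∧ ∀ L : ℝ, 0 < L →
      ∫ τ in Ioo (l ^ (5 / 2 : ℝ) * τ₀) τ₀,
          ∫ y in {y : EuclideanSpace ℝ (Fin 3) | 2 * L / l ≤ ‖y‖ ∧ ‖y‖ ≤ L}, ‖u τ y‖ ^ 2 ≤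
        K / L * ((∫ τ in Ioo (l ^ (5 / 2 : ℝ) * τ₀) τ₀,
            ∫ y in {y : EuclideanSpace ℝ (Fin 3) | L ≤ ‖y‖ ∧ ‖y‖ ≤ 2 * L},
              (‖u τ y‖ ^ 3 + 2 * (|p τ y| * ‖u τ y‖))) +
          l * ∫ τ in Ioo (l ^ (5 / 2 : ℝ) * τ₀) τ₀,
            ∫ y in {y : EuclideanSpace ℝ (Fin 3) | L / l ≤ ‖y‖ ∧ ‖y‖ ≤ 2 * L / l},
              (‖u τ y‖ ^ 3 + 2 * (|p τ y| * ‖u τ y‖))) := by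
  -- constants of the member
  have hl0 : 0 < l := by linarith
  have hl1 : 1 < l := by linarith
  set b : ℝ := l ^ (5 / 2 : ℝ) with hb
  have hb1 : 1 < b := Real.one_lt_rpow hl1 (by norm_num)
  have hb0 : 0 < b := by linarith
  set a : ℝ := l ^ (3 / 2 : ℝ) with ha
  have ha2 : a ^ 2 = l ^ 3 := by rw [ha, ← Real.rpow_natCast, ← Real.rpow_mul hl0.le]; norm_num
  have hbl : b * l ^ (-(3 / 2 : ℝ)) = l := by rw [hb, ← Real.rpow_add hl0]; norm_num
  -- the period and its length
  set T : ℝ := τ₀ - b * τ₀ with hT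
  have hbτ : b * τ₀ < τ₀ := by nlinarith
  have hT0 : 0 < T := by rw [hT]; linarith
  have hbb : b * (b * τ₀) < b * τ₀ := mul_lt_mul_of_pos_left hbτ hb0
  -- measurability of `u`, `p` on the slab; `|u|³ ∈ L¹_loc`
  have hum : AEStronglyMeasurable (uncurry u)
      (volume.restrict (Iio (0 : ℝ) ×ˢ (univ : Set (EuclideanSpace ℝ (Fin 3))))) := by
    obtain ⟨G, hG, -, -⟩ := hsw.localEnergy
    simpa [slab] using hG.locallyIntegrableOn.aestronglyMeasurable
  have hu3 := locallyIntegrableOn_cube_of_suitable hsw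
  -- the cut-offs at scales `L` and `L/l`
  obtain ⟨S, Kσ, hKσ0, hSrel, hS⟩ := exists_cutoffFamily
  refine ⟨T * Kσ / 2, by positivity, fun L hL => ?_⟩
  have hLl : 0 < 2 * L / l := by positivity
  have hLl' : 2 * L / l ≤ L := by rw [div_le_iff₀ hl0]; nlinarith
  obtain ⟨hσL_smooth, hσL_cpt, hσL_cont, hσL_nonneg, hσL_le, hσL_one', hσL_zero, hgradL_norm,
    hgradL_supp'⟩ := hS (2 * L) (by positivity)
  obtain ⟨-, -, hσLl_cont, hσLl_nonneg, hσLl_le, -, hσLl_zero, -, -⟩ := hS (2 * L / l) hLl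
  set σL : EuclideanSpace ℝ (Fin 3) → ℝ := S (2 * L) with hσL
  set σLl : EuclideanSpace ℝ (Fin 3) → ℝ := S (2 * L / l) with hσLl
  have hσL_one : ∀ y : EuclideanSpace ℝ (Fin 3), ‖y‖ ≤ L → σL y = 1 :=
    fun y hy => hσL_one' y (by linarith)
  have hgradL_supp : ∀ y, gradient σL y ≠ 0 → L ≤ ‖y‖ ∧ ‖y‖ ≤ 2 * L := fun y hy => by
    have := hgradL_supp' y hy; exact ⟨by linarith [this.1], this.2⟩
  have hσLl_eq : ∀ z : EuclideanSpace ℝ (Fin 3), σL (l • z) = σLl z :=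
    fun z => hSrel (2 * L) l z hl0.ne'
  -- `σLl ≤ σL` and `σL − σLl = 1` on the shell `2L/l ≤ |y| ≤ L`
  have hσdiff_nonneg : ∀ y : EuclideanSpace ℝ (Fin 3), 0 ≤ σL y - σLl y := fun y => by
    by_cases hy : ‖y‖ ≤ L
    · rw [hσL_one y hy]; linarith [hσLl_le y]
    · rw [not_le] at hy
      rw [hσLl_zero y (by linarith)]; linarith [hσL_nonneg y]
  -- sets
  set I₀ : Set ℝ := Ioo (b * τ₀) τ₀ with hI₀
  set I₁ : Set ℝ := Ioo (b * (b * τ₀)) (b * τ₀) with hI₁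
  set J : Set ℝ := Ioo (b * (b * τ₀)) τ₀ with hJ
  set SL : Set (EuclideanSpace ℝ (Fin 3)) := {y | L ≤ ‖y‖ ∧ ‖y‖ ≤ 2 * L} with hSL
  set SLl : Set (EuclideanSpace ℝ (Fin 3)) := {y | L / l ≤ ‖y‖ ∧ ‖y‖ ≤ 2 * L / l} with hSLl
  set AL : Set (EuclideanSpace ℝ (Fin 3)) := {y | 2 * L / l ≤ ‖y‖ ∧ ‖y‖ ≤ L} with hAL
  have hSLm : MeasurableSet SL := (measurableSet_le measurable_const measurable_norm).inter
    (measurableSet_le measurable_norm measurable_const)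
  have hSLlm : MeasurableSet SLl := (measurableSet_le measurable_const measurable_norm).inter
    (measurableSet_le measurable_norm measurable_const)
  have hALm : MeasurableSet AL := (measurableSet_le measurable_const measurable_norm).inter
    (measurableSet_le measurable_norm measurable_const)
  have hI₀J : I₀ ⊆ J := Ioo_subset_Ioo hbb.le le_rfl
  have hI₁J : I₁ ⊆ J := Ioo_subset_Ioo le_rfl hbτ.le
  -- the flux density and its integrability on `J̄ × B̄_{2L}`
  set F : ℝ → EuclideanSpace ℝ (Fin 3) → ℝ := fun τ y => ‖u τ y‖ ^ 3 + 2 * (|p τ y| * ‖u τ y‖) with hF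
  have hF0 : ∀ τ y, 0 ≤ F τ y := fun τ y => by positivity
  set K' : Set (ℝ × EuclideanSpace ℝ (Fin 3)) :=
    Icc (b * (b * τ₀)) τ₀ ×ˢ closedBall (0 : EuclideanSpace ℝ (Fin 3)) (2 * L) with hK'
  have hK'c : IsCompact K' := isCompact_Icc.prod (isCompact_closedBall _ _)
  have hK'S : K' ⊆ ((slab (EuclideanSpace ℝ (Fin 3)) (Iio 0) isOpen_Iio :
      Opens (ℝ × EuclideanSpace ℝ (Fin 3))) : Set (ℝ × EuclideanSpace ℝ (Fin 3))) := by
    rintro ⟨t, x⟩ ⟨ht, -⟩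
    rw [SetLike.mem_coe, mem_slab]
    exact lt_of_le_of_lt ht.2 hτ₀
  have hFK' : IntegrableOn (fun z : ℝ × EuclideanSpace ℝ (Fin 3) => F z.1 z.2) K' volume := by
    exact (hu3.integrableOn_compact_subset hK'S hK'c).add
      ((integrableOn_pressure_velocity_of_suitable hsw hK'c hK'S).const_mul 2)
  have hFJ : IntegrableOn (fun z : ℝ × EuclideanSpace ℝ (Fin 3) => F z.1 z.2) (J ×ˢ SL) volume :=
    hFK'.mono_set (prod_mono Ioo_subset_Icc_self fun y hy => by
      rw [mem_closedBall, dist_zero_right]; exact hy.2)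
  -- the flux bound `Φ`
  set Φ : ℝ := Kσ / (2 * L) * ∫ z in J ×ˢ SL, F z.1 z.2 with hΦ
  -- (1) the two-time local energy inequality against `σL`
  have hLEI := ae_energy_le_add_flux le_rfl hsw hσL_smooth hσL_cpt hσL_nonneg
  -- (2) the flux over `[τ₁, τ₂) ⊆ J` is at most `Φ`
  have hflux : ∀ τ₁ τ₂, τ₁ ∈ I₁ → τ₂ ∈ I₀ →
      ∫ z in Ico τ₁ τ₂ ×ˢ (univ : Set (EuclideanSpace ℝ (Fin 3))),
        (‖u z.1 z.2‖ ^ 2 * (0 * Δ σL z.2) +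
          (‖u z.1 z.2‖ ^ 2 + 2 * p z.1 z.2) * ⟪u z.1 z.2, gradient σL z.2⟫) ≤ Φ := by
    intro τ₁ τ₂ h₁ h₂
    set g : ℝ × EuclideanSpace ℝ (Fin 3) → ℝ := fun z =>
      Kσ / (2 * L) * ((univ : Set ℝ) ×ˢ SL).indicator (fun z => F z.1 z.2) z with hg
    have hg0 : ∀ z, 0 ≤ g z := fun z => mul_nonneg (by positivity)
      (indicator_nonneg (fun w _ => hF0 w.1 w.2) _)
    have hGg : ∀ z : ℝ × EuclideanSpace ℝ (Fin 3),
        ‖(‖u z.1 z.2‖ ^ 2 * (0 * Δ σL z.2) +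
          (‖u z.1 z.2‖ ^ 2 + 2 * p z.1 z.2) * ⟪u z.1 z.2, gradient σL z.2⟫)‖ ≤ g z := by
      intro z
      rw [zero_mul, mul_zero, zero_add, Real.norm_eq_abs, abs_mul]
      by_cases hgz : gradient σL z.2 = 0
      · rw [hgz, inner_zero_right, abs_zero, mul_zero]; exact hg0 z
      · have hz : z ∈ (univ : Set ℝ) ×ˢ SL := ⟨mem_univ _, hgradL_supp _ hgz⟩
        show _ ≤ Kσ / (2 * L) * ((univ : Set ℝ) ×ˢ SL).indicator (fun z => F z.1 z.2) z
        rw [indicator_of_mem hz]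
        calc |‖u z.1 z.2‖ ^ 2 + 2 * p z.1 z.2| * |⟪u z.1 z.2, gradient σL z.2⟫|
            ≤ (‖u z.1 z.2‖ ^ 2 + 2 * |p z.1 z.2|) * (‖u z.1 z.2‖ * ‖gradient σL z.2‖) := by
              refine mul_le_mul ?_ (abs_real_inner_le_norm _ _) (abs_nonneg _) (by positivity)
              calc |‖u z.1 z.2‖ ^ 2 + 2 * p z.1 z.2| ≤ |‖u z.1 z.2‖ ^ 2| + |2 * p z.1 z.2| :=
                    abs_add_le _ _
                _ = ‖u z.1 z.2‖ ^ 2 + 2 * |p z.1 z.2| := by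
                    rw [abs_of_nonneg (by positivity), abs_mul, abs_of_pos (by norm_num : (0:ℝ) < 2)]
          _ ≤ (‖u z.1 z.2‖ ^ 2 + 2 * |p z.1 z.2|) * (‖u z.1 z.2‖ * (Kσ / (2 * L))) := by
              gcongr; exact hgradL_norm _
          _ = Kσ / (2 * L) * F z.1 z.2 := by rw [hF]; ring
    have hsub : Ico τ₁ τ₂ ×ˢ (univ : Set (EuclideanSpace ℝ (Fin 3))) ⊆ J ×ˢ univ :=
      prod_mono (fun t ht => ⟨h₁.1.trans_le ht.1, ht.2.trans h₂.2⟩) subset_rfl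
    have hset : (univ : Set ℝ) ×ˢ SL ∩ J ×ˢ (univ : Set (EuclideanSpace ℝ (Fin 3))) = J ×ˢ SL := by
      rw [prod_inter_prod, univ_inter, inter_univ]
    have hgJ : IntegrableOn g (J ×ˢ (univ : Set (EuclideanSpace ℝ (Fin 3)))) volume := by
      have h1 : IntegrableOn (((univ : Set ℝ) ×ˢ SL).indicator
          fun z : ℝ × EuclideanSpace ℝ (Fin 3) => F z.1 z.2)
          (J ×ˢ (univ : Set (EuclideanSpace ℝ (Fin 3)))) volume := by
        rw [IntegrableOn, integrable_indicator_iff (MeasurableSet.univ.prod hSLm), IntegrableOn,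
          Measure.restrict_restrict (MeasurableSet.univ.prod hSLm), hset]
        exact hFJ
      exact h1.const_mul _
    have hset' : J ×ˢ (univ : Set (EuclideanSpace ℝ (Fin 3))) ∩ (univ : Set ℝ) ×ˢ SL = J ×ˢ SL := by
      rw [prod_inter_prod, inter_univ, univ_inter]
    have h1 := norm_integral_le_of_norm_le (hgJ.mono_set hsub) (Eventually.of_forall hGg)
    rw [Real.norm_eq_abs] at h1
    refine (le_abs_self _).trans (h1.trans ?_)
    calc ∫ z in Ico τ₁ τ₂ ×ˢ (univ : Set (EuclideanSpace ℝ (Fin 3))), g z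
        ≤ ∫ z in J ×ˢ (univ : Set (EuclideanSpace ℝ (Fin 3))), g z :=
          setIntegral_mono_set hgJ (Eventually.of_forall hg0) hsub.eventuallyLE
      _ = Φ := by
          simp only [hg, hΦ]
          rw [integral_const_mul, setIntegral_indicator (MeasurableSet.univ.prod hSLm), hset']
  -- (3) DSS: the energy of the slice `b τ` against `σL` is the energy of the slice `τ` against `σLl`
  set EL : ℝ → ℝ := fun τ => ∫ y, ‖u τ y‖ ^ 2 * σL y with hEL
  set ELl : ℝ → ℝ := fun τ => ∫ y, ‖u τ y‖ ^ 2 * σLl y with hELl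
  have hEL_dss : ∀ τ, τ < 0 → EL (b * τ) = ELl τ := by
    intro τ hτ
    have h := integral_norm_sq_mul_of_dss_slice (V := u τ) (W := u (b * τ)) hl0 ha2
      (fun y => hu τ hτ y) σL
    show (∫ y, ‖u (b * τ) y‖ ^ 2 * σL y) = ∫ y, ‖u τ y‖ ^ 2 * σLl y
    rw [h]
    congr 1; funext z; rw [hσLl_eq]
  -- (4) the inequality for a.e. pair of times of the period `I₀`
  have hgood : ∀ᵐ τ₁' : ℝ, τ₁' ∈ I₀ → ∀ᵐ τ₂ : ℝ, τ₂ ∈ I₀ → EL τ₂ ≤ ELl τ₁' + Φ := by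
    have h1 := ae_comp_mul_left hLEI hb0.ne'
    filter_upwards [h1] with τ₁' hτ₁' hmem
    have hτ₁'0 : τ₁' < 0 := hmem.2.trans hτ₀
    have hbτ₁' : b * τ₁' < 0 := mul_neg_of_pos_of_neg hb0 hτ₁'0
    have h2 := hτ₁' hbτ₁'
    filter_upwards [h2] with τ₂ hτ₂ hτ₂mem
    have hlt : b * τ₁' < b * τ₀ := mul_lt_mul_of_pos_left hmem.2 hb0
    have hτ₂' : τ₂ ∈ Ioo (b * τ₁') 0 := ⟨hlt.trans hτ₂mem.1, hτ₂mem.2.trans hτ₀⟩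
    have h3 := hτ₂ hτ₂'
    have h4 := hflux (b * τ₁') τ₂ ⟨mul_lt_mul_of_pos_left hmem.1 hb0, hlt⟩ hτ₂mem
    have h5 : (∫ y, ‖u (b * τ₁') y‖ ^ 2 * σL y) = ELl τ₁' := hEL_dss τ₁' hτ₁'0
    show (∫ y, ‖u τ₂ y‖ ^ 2 * σL y) ≤ ELl τ₁' + Φ
    linarith
  -- (5) slice energies are bounded on `J` (energy class of the member)
  obtain ⟨C, hC⟩ := exists_ae_slice_energy_facts hsw (α := b * (b * τ₀)) hτ₀ (2 * L)
  have hball : ∀ᵐ t : ℝ, t ∈ J → AEStronglyMeasurable (u t) volume ∧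
      IntegrableOn (fun y => ‖u t y‖ ^ 2) (closedBall (0 : EuclideanSpace ℝ (Fin 3)) (2 * L)) volume := by
    filter_upwards [hC] with t ht htJ
    exact ⟨(ht htJ).1, (ht htJ).2.1⟩
  have hEw : ∀ w : EuclideanSpace ℝ (Fin 3) → ℝ, Continuous w → (∀ y, 0 ≤ w y) → (∀ y, w y ≤ 1) →
      (∀ y, 2 * L ≤ ‖y‖ → w y = 0) →
      ∀ᵐ t : ℝ, t ∈ J → Integrable (fun y => ‖u t y‖ ^ 2 * w y) volume ∧
        0 ≤ ∫ y, ‖u t y‖ ^ 2 * w y ∧ ∫ y, ‖u t y‖ ^ 2 * w y ≤ C := by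
    intro w hwc hw0 hw1 hwz
    filter_upwards [hC] with t ht htJ
    exact (ht htJ).2.2.2 w hwc hw0 hw1 hwz
  -- measurability in time of the slice functionals
  have hJ0 : J ⊆ Iio 0 := fun t ht => ht.2.trans hτ₀
  have hmeasE : ∀ w : EuclideanSpace ℝ (Fin 3) → ℝ, Continuous w →
      AEStronglyMeasurable (fun τ => ∫ y, ‖u τ y‖ ^ 2 * w y) (volume.restrict J) :=
    fun w hwc => aestronglyMeasurable_sliceWeightEnergy hum hJ0 hwc
  have hmeasA : AEStronglyMeasurable (fun τ => ∫ y in AL, ‖u τ y‖ ^ 2) (volume.restrict J) :=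
    aestronglyMeasurable_sliceSetEnergy hum hJ0 hALm
  -- integrability on `I₀` of bounded nonnegative slice functionals
  have hintI₀ : ∀ g : ℝ → ℝ, AEStronglyMeasurable g (volume.restrict J) →
      (∀ᵐ t : ℝ, t ∈ J → 0 ≤ g t ∧ g t ≤ C) → IntegrableOn g I₀ volume := by
    intro g hgm hgb
    have hgm' : AEStronglyMeasurable g (volume.restrict I₀) :=
      hgm.mono_measure (Measure.restrict_mono hI₀J le_rfl)
    refine Integrable.mono' (integrable_const (C : ℝ)) hgm' ?_
    rw [ae_restrict_iff' measurableSet_Ioo]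
    filter_upwards [hgb] with t ht htI
    obtain ⟨h0, h1⟩ := ht (hI₀J htI)
    rw [Real.norm_eq_abs, abs_of_nonneg h0]; exact h1
  have hELw := hEw σL hσL_cont hσL_nonneg hσL_le hσL_zero
  have hELlw := hEw σLl hσLl_cont hσLl_nonneg hσLl_le (fun y hy => hσLl_zero y (by linarith))
  have hELint : IntegrableOn EL I₀ volume :=
    hintI₀ EL (hmeasE σL hσL_cont) (by
      filter_upwards [hELw] with t ht htJ
      exact ⟨(ht htJ).2.1, (ht htJ).2.2⟩)
  have hELlint : IntegrableOn ELl I₀ volume :=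
    hintI₀ ELl (hmeasE σLl hσLl_cont) (by
      filter_upwards [hELlw] with t ht htJ
      exact ⟨(ht htJ).2.1, (ht htJ).2.2⟩)
  -- the shell energy of a slice is below `EL − ELl`
  have heA_le : ∀ᵐ t : ℝ, t ∈ J → 0 ≤ ∫ y in AL, ‖u t y‖ ^ 2 ∧
      ∫ y in AL, ‖u t y‖ ^ 2 ≤ EL t - ELl t := by
    filter_upwards [hball, hELw, hELlw] with t hb' h1 h2 htJ
    obtain ⟨-, hI⟩ := hb' htJ
    obtain ⟨hi1, -, -⟩ := h1 htJ
    obtain ⟨hi2, -, -⟩ := h2 htJ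
    refine ⟨setIntegral_nonneg hALm fun y _ => by positivity, ?_⟩
    have hAsub : AL ⊆ closedBall (0 : EuclideanSpace ℝ (Fin 3)) (2 * L) := fun y hy => by
      rw [mem_closedBall, dist_zero_right]; linarith [hy.2]
    have hIA : Integrable (AL.indicator fun y => ‖u t y‖ ^ 2) volume :=
      (hI.mono_set hAsub).integrable_indicator hALm
    show (∫ y in AL, ‖u t y‖ ^ 2) ≤ (∫ y, ‖u t y‖ ^ 2 * σL y) - ∫ y, ‖u t y‖ ^ 2 * σLl y
    rw [← integral_sub hi1 hi2, ← integral_indicator hALm]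
    refine integral_mono hIA (hi1.sub hi2) fun y => ?_
    by_cases hy : y ∈ AL
    · rw [indicator_of_mem hy]
      show ‖u t y‖ ^ 2 ≤ ‖u t y‖ ^ 2 * σL y - ‖u t y‖ ^ 2 * σLl y
      rw [hσL_one y hy.2, hσLl_zero y hy.1]; linarith
    · rw [indicator_of_notMem hy]
      show (0 : ℝ) ≤ ‖u t y‖ ^ 2 * σL y - ‖u t y‖ ^ 2 * σLl y
      rw [← mul_sub]
      exact mul_nonneg (by positivity) (hσdiff_nonneg y)
  have heAint : IntegrableOn (fun τ => ∫ y in AL, ‖u τ y‖ ^ 2) I₀ volume :=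
    hintI₀ _ hmeasA (by
      filter_upwards [heA_le, hELw, hELlw] with t ht h1 h2 htJ
      refine ⟨(ht htJ).1, (ht htJ).2.trans ?_⟩
      have := (h1 htJ).2.2
      have := (h2 htJ).2.1
      show EL t - ELl t ≤ C
      linarith)
  -- (6) average over `τ₂ ∈ I₀`
  have hstep1 : ∀ᵐ τ₁' : ℝ, τ₁' ∈ I₀ → (∫ τ in I₀, EL τ) ≤ T * ELl τ₁' + T * Φ := by
    filter_upwards [hgood] with τ₁' h hmem
    have h' : ∀ᵐ τ₂ ∂(volume.restrict I₀), EL τ₂ ≤ ELl τ₁' + Φ :=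
      (ae_restrict_iff' measurableSet_Ioo).2 (h hmem)
    calc (∫ τ in I₀, EL τ) ≤ ∫ τ in I₀, (ELl τ₁' + Φ) :=
          setIntegral_mono_ae_restrict hELint (integrable_const _) h'
      _ = T * ELl τ₁' + T * Φ := by
          rw [setIntegral_const, Real.volume_real_Ioo_of_le hbτ.le, smul_eq_mul, hT]; ring
  -- (7) average over `τ₁' ∈ I₀`
  have hstep2 : (∫ τ in I₀, EL τ) ≤ (∫ τ in I₀, ELl τ) + T * Φ := by
    have h' : ∀ᵐ τ₁' ∂(volume.restrict I₀), (∫ τ in I₀, EL τ) ≤ T * ELl τ₁' + T * Φ :=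
      (ae_restrict_iff' measurableSet_Ioo).2 hstep1
    have h1 : (∫ τ in I₀, (∫ τ' in I₀, EL τ')) ≤ ∫ τ in I₀, (T * ELl τ + T * Φ) :=
      setIntegral_mono_ae_restrict (integrable_const _)
        ((hELlint.const_mul T).add (integrable_const _)) h'
    rw [setIntegral_const, integral_add (hELlint.const_mul T) (integrable_const _),
      integral_const_mul, setIntegral_const, Real.volume_real_Ioo_of_le hbτ.le, smul_eq_mul,
      smul_eq_mul, ← hT] at h1
    have h2 : T * (∫ τ in I₀, EL τ) ≤ T * ((∫ τ in I₀, ELl τ) + T * Φ) := by linarith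
    exact le_of_mul_le_mul_left h2 hT0
  -- (8) the period-integrated shell energy is below `T Φ`
  have hshell : (∫ τ in I₀, ∫ y in AL, ‖u τ y‖ ^ 2) ≤ T * Φ := by
    have h1 : (∫ τ in I₀, ∫ y in AL, ‖u τ y‖ ^ 2) ≤ ∫ τ in I₀, (EL τ - ELl τ) := by
      refine setIntegral_mono_ae_restrict heAint (hELint.sub hELlint) ?_
      exact (ae_restrict_iff' measurableSet_Ioo).2 (by
        filter_upwards [heA_le] with t ht htI
        exact (ht (hI₀J htI)).2)
    rw [integral_sub hELint hELlint] at h1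
    linarith
  -- (9) Fubini and the DSS substitution in the flux bound
  set QL : ℝ → ℝ := fun τ => ∫ y in SL, F τ y with hQL
  set QLl : ℝ → ℝ := fun τ => ∫ y in SLl, F τ y with hQLl
  have hFubini : (∫ z in J ×ˢ SL, F z.1 z.2) = ∫ τ in J, QL τ := by
    have hFJ' : IntegrableOn (fun z : ℝ × EuclideanSpace ℝ (Fin 3) => F z.1 z.2) (J ×ˢ SL)
        ((volume : Measure ℝ).prod (volume : Measure (EuclideanSpace ℝ (Fin 3)))) := by
      rw [← Measure.volume_eq_prod]; exact hFJ
    rw [Measure.volume_eq_prod, setIntegral_prod _ hFJ']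
  have hQLint : IntegrableOn QL J volume := by
    have h : Integrable (fun z : ℝ × EuclideanSpace ℝ (Fin 3) => F z.1 z.2)
        ((volume.restrict J).prod (volume.restrict SL)) := by
      rw [Measure.prod_restrict, ← Measure.volume_eq_prod]; exact hFJ
    exact h.integral_prod_left
  have hsplit : (∫ τ in J, QL τ) = (∫ τ in I₁, QL τ) + ∫ τ in I₀, QL τ := by
    have hJ' : J = I₁ ∪ Ico (b * τ₀) τ₀ := (Ioo_union_Ico_eq_Ioo hbb hbτ.le).symm
    have hdisj : Disjoint I₁ (Ico (b * τ₀) τ₀) :=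
      disjoint_left.2 fun x hx hx' => (not_le.2 hx.2) hx'.1
    have hIcoJ : Ico (b * τ₀) τ₀ ⊆ J := fun t ht => ⟨hbb.trans_le ht.1, ht.2⟩
    rw [hJ', setIntegral_union hdisj measurableSet_Ico (hQLint.mono_set hI₁J) (hQLint.mono_set hIcoJ)]
    congr 1
    exact setIntegral_congr_set Ioo_ae_eq_Ico.symm
  have hI₁eq : (∫ τ in I₁, QL τ) = l * ∫ τ in I₀, QLl τ := by
    have hind1 : ∀ (G : EuclideanSpace ℝ (Fin 3) → ℝ) (S : Set (EuclideanSpace ℝ (Fin 3))),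
        MeasurableSet S → (∫ y, G y * S.indicator (fun _ => (1 : ℝ)) y) = ∫ y in S, G y := by
      intro G S hS
      rw [← integral_indicator hS]
      congr 1; funext y
      by_cases hy : y ∈ S
      · rw [indicator_of_mem hy, indicator_of_mem hy, mul_one]
      · rw [indicator_of_notMem hy, indicator_of_notMem hy, mul_zero]
    have hind2 : ∀ z : EuclideanSpace ℝ (Fin 3),
        SL.indicator (fun _ => (1 : ℝ)) (l • z) = SLl.indicator (fun _ => (1 : ℝ)) z := by
      intro z
      have hn : ‖l • z‖ = l * ‖z‖ := by rw [norm_smul, Real.norm_eq_abs, abs_of_pos hl0]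
      by_cases hz : z ∈ SLl
      · have hz' : l • z ∈ SL :=
          ⟨by rw [hn]; exact (div_le_iff₀' hl0).1 hz.1, by rw [hn]; exact (le_div_iff₀' hl0).1 hz.2⟩
        rw [indicator_of_mem hz, indicator_of_mem hz']
      · have hz' : l • z ∉ SL := fun h => hz
          ⟨(div_le_iff₀' hl0).2 (hn ▸ h.1), (le_div_iff₀' hl0).2 (hn ▸ h.2)⟩
        rw [indicator_of_notMem hz, indicator_of_notMem hz']
    have hpt : ∀ τ ∈ I₀, QL (b * τ) = l ^ (-(3 / 2 : ℝ)) * QLl τ := by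
      intro τ hτ
      have hτ0 : τ < 0 := hτ.2.trans hτ₀
      have key := integral_flux_mul_of_dss_slice (V := u τ) (W := u (b * τ)) (P := p τ)
        (Q := p (b * τ)) hl0 ha (fun y => hu τ hτ0 y) (fun y => hp τ hτ0 y)
        (SL.indicator fun _ => (1 : ℝ))
      show (∫ y in SL, F (b * τ) y) = l ^ (-(3 / 2 : ℝ)) * ∫ y in SLl, F τ y
      rw [← hind1 _ SL hSLm, ← hind1 _ SLl hSLlm]
      simp only [hF]
      rw [key]
      congr 2; funext z; rw [hind2]
    show (∫ τ in Ioo (b * (b * τ₀)) (b * τ₀), QL τ) = l * ∫ τ in I₀, QLl τ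
    rw [setIntegral_Ioo_comp_mul_left hb0, setIntegral_congr_fun measurableSet_Ioo hpt,
      integral_const_mul, ← mul_assoc, hbl]
  -- (10) assemble
  calc (∫ τ in I₀, ∫ y in AL, ‖u τ y‖ ^ 2) ≤ T * Φ := hshell
    _ = T * Kσ / 2 / L * ((∫ τ in I₀, QL τ) + l * ∫ τ in I₀, QLl τ) := by
        rw [hΦ, hFubini, hsplit, hI₁eq]
        field_simp
        ring

end PeriodShell

end Summit.NavierStokesRegularity.NavierStokesRegularity.Theorems.PowerGaugeEulerLiouville
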